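import Mathlib
import HarnessLib
import Summits.NavierStokesRegularity.NavierStokesRegularity.Theorems.UnthreadedDoorNetFluxStratumLiouville
import Summits.NavierStokesRegularity.NavierStokesRegularity.Theorems.UnthreadedDoorNetFluxNSSpatialAnalyticity
import Summits.NavierStokesRegularity.NavierStokesRegularity.Theorems.UnthreadedDoorNetFluxNullTimeGaugeTransfer
import Summits.NavierStokesRegularity.NavierStokesRegularity.Theorems.UnthreadedDoorNetFluxWindowDecayOffNull

/-!
# Route `UnthreadedDoor`, crux `PoloidalLiouville` (stmt-NavierStokesRegularity-1222), WALL W1 — crux idea «null-time»: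
# THE THIRD-STRATUM RUNG K3ᵃᵉ `NullTimeDenseFiniteZeroScalarLiouvilleTypeI`, Theorems side, BY NAME

`nullTimeDenseFiniteZeroScalarLiouvilleTypeI_holds` = the body of ns-idea-14's `NullTime.NullTimeDenseFiniteZeroScalarLiouvilleTypeI`
(`Cruxes/PoloidalLiouville/NullTimeSketch.lean` v1.2, §1) VERBATIM with `sphCrit` unfolded: a bounded ancient mild solution (duality form),
Type-I in time, smooth on the past slab, unthreaded about `x₀` (`curl v = ∇T × (x − x₀)`, `T` bounded and smooth off `x₀`, curled law
(E1)), such that the radii whose sphere carries finitely many vorticity zeros are dense in `(0,∞)` at every `t < 0` OUTSIDE SOME CLOSED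
LEBESGUE-NULL SET OF TIMES, has `ω ≡ 0`.  Composition of landed Theorems: HH-0 `nsSpatialAnalyticity` (p682567) → AE-6
`nullTimeDenseFinite_of_analytic` (p687507, ns-qj-p1) over [AE-5 = the generic `scalarLiouvilleTypeIOn_of_netFluxWindowDecayOn`
(p678536) at the stratum «off `D` ⇒ height-head condition»] ∘ AE-4′ `netFluxWindowDecayOffNull` (p688382; inside it AE-1 p686638,
AE-2′ `halfLineOU_decay_viscosity_offNull` p687414, AE-3 p686120, `viscosity_inequality_window_at` p687801).
HONEST LABEL: stratum theorem #3 below W1, strictly containing K3ᶠ (p684266, `D = ∅`) and the unimodal rung (p675773); the residual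
`PersistentSheetResidualTypeI` (null sheets on a time set not coverable by a closed null set), C⁻'s `MultiHillScalarLiouvilleTypeI`,
`PoloidalLiouville` (1222), `stub_scalarLiouville`, W1 and NS regularity remain OPEN.
`--supports stmt-NavierStokesRegularity-1222 --as helper`.  [folklore]
-/

noncomputable section

-- the summit and its single sub-problem share the name (CONVENTIONS §1)
set_option linter.dupNamespace false

open Set Function Filter Topology MeasureTheory
open scoped RealInnerProductSpace

namespace Summit.NavierStokesRegularity.NavierStokesRegularity.Theorems.PoloidalLiouville.NetFlux

open Literature.Analysis Literature.Analysis.FluidPDE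

/-- **Type-I scalar Liouville on the stratum «height-head condition off a closed null set of times»** — AE-5 (the generic
`scalarLiouvilleTypeIOn_of_netFluxWindowDecayOn`, p678536) fed with AE-4′ `netFluxWindowDecayOffNull` (p688382). [folklore] -/
theorem scalarLiouvilleTypeI_offNull : ∀ D : Set ℝ, IsClosed D → volume D = 0 →
    ∀ (v : ℝ → E3 → E3) (x₀ : E3) (T : ℝ → E3 → ℝ),
      (∃ C : ℝ, HasTypeITimeDecay C v) →
      IsBoundedAncientMildSolution 1 v →
      (∀ t < 0, AEStronglyMeasurable (v t) volume) →
      ContDiffOn ℝ (⊤ : ℕ∞) (uncurry v) (Iio 0 ×ˢ univ) →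
      ContDiffOn ℝ (⊤ : ℕ∞) (uncurry T) (Iio 0 ×ˢ ({x₀}ᶜ : Set E3)) →
      (∃ C : ℝ, ∀ t < 0, ∀ x, |T t x| ≤ C) →
      (∀ t < 0, ∀ x, curl (v t) x = cross (gradient (T t) x) (x - x₀)) →
      CurledLaw v x₀ T (Iio 0) →
      (∀ t < 0, t ∉ D →
        AnalyticOnNhd ℝ (v t) (univ : Set E3) ∧ AnalyticOnNhd ℝ (T t) ({x₀}ᶜ : Set E3) ∧
          Ioi (0 : ℝ) ⊆ closure {r : ℝ | 0 < r ∧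
            {x : E3 | x ∈ Metric.sphere x₀ r ∧ cross (gradient (T t) x) (x - x₀) = 0}.Finite}) →
      ∀ t < 0, ∀ x, cross (gradient (T t) x) (x - x₀) = 0 :=
  fun D hD hD0 =>
    scalarLiouvilleTypeIOn_of_netFluxWindowDecayOn
      (fun v x₀ T t => t ∉ D →
        AnalyticOnNhd ℝ (v t) (univ : Set E3) ∧ AnalyticOnNhd ℝ (T t) ({x₀}ᶜ : Set E3) ∧
          Ioi (0 : ℝ) ⊆ closure {r : ℝ | 0 < r ∧
            {x : E3 | x ∈ Metric.sphere x₀ r ∧ cross (gradient (T t) x) (x - x₀) = 0}.Finite})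
      (netFluxWindowDecayOffNull D hD hD0)

/-- **THE THIRD-STRATUM RUNG K3ᵃᵉ, BY NAME: `NullTime.NullTimeDenseFiniteZeroScalarLiouvilleTypeI` (sketch v1.2 §1) — binders VERBATIM
with `sphCrit` unfolded.**  Bounded ancient mild NS (duality form), Type-I in time, smooth on the past slab, unthreaded about `x₀` with the
curled law (E1), and the finite-vorticity-zero radii dense at every `t < 0` outside some closed Lebesgue-null set of times ⟹ `ω ≡ 0`.
Proof: HH-0 ⊢ AE-6 (`nullTimeDenseFinite_of_analytic`) over `scalarLiouvilleTypeI_offNull`.  HONEST: a decided sub-class of W1; the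
residual `PersistentSheetResidualTypeI`, 1222, W1 and NS regularity are OPEN. [folklore] -/
theorem nullTimeDenseFiniteZeroScalarLiouvilleTypeI_holds :
    ∀ (v : ℝ → E3 → E3) (x₀ : E3) (T : ℝ → E3 → ℝ),
      (∃ C : ℝ, HasTypeITimeDecay C v) →
      IsBoundedAncientMildSolution 1 v →
      (∀ t < 0, AEStronglyMeasurable (v t) volume) →
      ContDiffOn ℝ (⊤ : ℕ∞) (uncurry v) (Iio 0 ×ˢ univ) →
      ContDiffOn ℝ (⊤ : ℕ∞) (uncurry T) (Iio 0 ×ˢ ({x₀}ᶜ : Set E3)) →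
      (∃ C : ℝ, ∀ t < 0, ∀ x, |T t x| ≤ C) →
      (∀ t < 0, ∀ x, curl (v t) x = cross (gradient (T t) x) (x - x₀)) →
      CurledLaw v x₀ T (Iio 0) →
      (∃ D : Set ℝ, IsClosed D ∧ volume D = 0 ∧
        ∀ t < 0, t ∉ D → Ioi (0 : ℝ) ⊆ closure {r : ℝ | 0 < r ∧
          {x : E3 | x ∈ Metric.sphere x₀ r ∧ cross (gradient (T t) x) (x - x₀) = 0}.Finite}) →
      ∀ t < 0, ∀ x, cross (gradient (T t) x) (x - x₀) = 0 :=
  nullTimeDenseFinite_of_analytic nsSpatialAnalyticity scalarLiouvilleTypeI_offNull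

end Summit.NavierStokesRegularity.NavierStokesRegularity.Theorems.PoloidalLiouville.NetFlux
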